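import Mathlib.NumberTheory.NumberField.CMField
import Mathlib.FieldTheory.PolynomialGaloisGroup
import Mathlib.FieldTheory.PrimitiveElement
import Mathlib.GroupTheory.Solvable
import Mathlib.GroupTheory.Perm.ViaEmbedding
import Mathlib.GroupTheory.SpecificGroups.Alternating.KleinFour
import HarnessLib

/-!
# Conjugation-solvable number fields

A number field `F` is **conjugation-solvable** if it sits in a tower `F₀ ⊆ F ⊆ E` of number
fields with `F₀` totally real and `E/F₀` a (finite) Galois extension with *solvable* Galois group
`Gal(E/F₀)`.  Equivalently (`IsConjugationSolvable.iff_maximalRealSubfield`) one may take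
`F₀ = F⁺ := NumberField.maximalRealSubfield F`, the maximal totally real subfield of `F`; so the
condition says that the Galois closure of `F` over `F⁺` is solvable, i.e. `F` is reachable from a
totally real field by going up a solvable Galois extension and down a Galois sub-extension — the
domain of Arthur–Clozel cyclic base change / automorphic induction / descent.

This is the predicate that the route `Summits/Langlands/Langlands/Theses/BaseFieldAscent`
(items `AscentConjugationSolvable`, `AscentResidual`) types INLINE as
`∃ (F₀ E : Type) … , NumberField.IsTotallyReal F₀ ∧ IsSolvable (E ≃ₐ[F₀] E)`; the definition
below is that term verbatim (universe-polymorphic; at universe `0` it is the route's term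
definitionally, see `isConjugationSolvable_iff`).

## Main results

* `IsConjugationSolvable F` : the predicate.
* `IsConjugationSolvable.of_isTotallyReal` : totally real fields are conjugation-solvable.
* `IsConjugationSolvable.of_finrank_le_four` : every extension of degree `≤ 4` of a totally real
  field is conjugation-solvable (its Galois closure has group inside `S₄`, which is solvable);
  hence quadratic extensions of totally real fields (`of_finrank_eq_two`), CM fields
  (`of_isCMField`) and every number field of absolute degree `≤ 4`, e.g. pure cubic fields
  `ℚ(∛m)` and `ℚ(2^{1/4})` (`of_finrank_rat_le_four`).
* `IsConjugationSolvable.iff_maximalRealSubfield` : the intrinsic form over `F⁺`.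
* `IsConjugationSolvable.not_of_prime_finrank` : a number field of prime absolute degree which
  is not totally real and contains an element whose minimal polynomial over `ℚ` has insoluble
  Galois group (e.g. an `S₅`- or `A₅`-quintic field with a complex place,
  `not_of_prime_finrank_of_mulEquiv_perm_fin_five`) is NOT conjugation-solvable.

## References

The terminology is the route's (idea card `Langlands/Langlands/conjugation-solvable-fields`);
the mathematics is folklore Galois theory.  Context: solvable base change, Arthur–Clozel,
*Simple algebras, base change, and the advanced theory of the trace formula* (1989), Ch. 3;
Getz–Hahn, *An Introduction to Automorphic Representations* (2024), §13.4–13.5.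

## Not here

The Galois closure itself (as `normalClosure`) is never needed: all statements quantify over an
arbitrary Galois extension `E ⊇ F`.  No automorphic content.
-/

namespace Literature.NumberTheory.NumberFields

open NumberField Polynomial Module

universe u

/-- A field `F` (in practice a number field) is **conjugation-solvable** if there are a totally
real number field `F₀`, an `F₀`-algebra structure on `F` (i.e. `F₀ ⊆ F`), and a number field
`E ⊇ F ⊇ F₀` which is Galois over `F₀` with solvable Galois group `E ≃ₐ[F₀] E`.
This is verbatim the inline hypothesis of the route items
`Summit.Langlands.Langlands.Theses.BaseFieldAscent.AscentConjugationSolvable` / `AscentResidual`.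
[folklore] -/
def IsConjugationSolvable (F : Type u) [Field F] : Prop :=
  ∃ (F₀ E : Type u) (_ : Field F₀) (_ : NumberField F₀) (_ : Field E) (_ : NumberField E)
    (_ : Algebra F₀ F) (_ : Algebra F E) (_ : Algebra F₀ E) (_ : IsScalarTower F₀ F E)
    (_ : IsGalois F₀ E), NumberField.IsTotallyReal F₀ ∧ IsSolvable (E ≃ₐ[F₀] E)

/-- Unfolding lemma at universe `0`: `IsConjugationSolvable F` is, by `Iff.rfl`, the term the
route `BaseFieldAscent` writes inline. [folklore] -/
theorem isConjugationSolvable_iff (F : Type) [Field F] :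
    IsConjugationSolvable F ↔
      ∃ (F₀ E : Type) (_ : Field F₀) (_ : NumberField F₀) (_ : Field E) (_ : NumberField E)
        (_ : Algebra F₀ F) (_ : Algebra F E) (_ : Algebra F₀ E) (_ : IsScalarTower F₀ F E)
        (_ : IsGalois F₀ E), NumberField.IsTotallyReal F₀ ∧ IsSolvable (E ≃ₐ[F₀] E) :=
  Iff.rfl

/-! ## Group theory: `S₄` and its subgroups are solvable -/

/-- `S₄` is solvable: `A₄` is solvable (derived series `A₄ ⊳ V₄ ⊳ 1`, from Mathlib's
`alternatingGroup.kleinFour_eq_commutator`; this is also the tree's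
`Literature.Barriers.Langlands.alternatingGroup_four_isSolvable`, re-derived inline to keep the
imports of this file inside Mathlib's field theory) and `S₄` is an extension of `{±1}` by `A₄`
via `sign`. [folklore] -/
theorem perm_fin_four_isSolvable : IsSolvable (Equiv.Perm (Fin 4)) := by
  haveI : IsSolvable (alternatingGroup (Fin 4)) := by
    have h4 : Nat.card (Fin 4) = 4 := by simp
    haveI := alternatingGroup.kleinFour_isKleinFour (α := Fin 4) h4
    refine ⟨⟨2, ?_⟩⟩
    rw [derivedSeries_succ, derivedSeries_one, ← alternatingGroup.kleinFour_eq_commutator h4,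
      Subgroup.commutator_self_eq_bot_iff]
    exact IsKleinFour.isMulCommutative
  exact solvable_of_ker_le_range (alternatingGroup (Fin 4)).subtype Equiv.Perm.sign
    (by rw [Subgroup.range_subtype]; exact le_rfl)

/-- The symmetric group of a set with at most `4` elements is solvable. [folklore] -/
theorem perm_isSolvable_of_card_le_four {X : Type*} [Fintype X] (h : Fintype.card X ≤ 4) :
    IsSolvable (Equiv.Perm X) := by
  obtain ⟨ι⟩ : Nonempty (X ↪ Fin 4) := Function.Embedding.nonempty_of_card_le (by simpa using h)
  haveI := perm_fin_four_isSolvable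
  exact solvable_of_solvable_injective (Equiv.Perm.viaEmbeddingHom_injective ι)

/-- The Galois group of a polynomial of degree `≤ 4` is solvable: it embeds into the
permutations of its (at most `4`) roots. [folklore] -/
theorem gal_isSolvable_of_natDegree_le_four {K : Type*} [Field K] {p : K[X]}
    (hp : p.natDegree ≤ 4) : IsSolvable p.Gal := by
  classical
  haveI : Fact ((p.map (algebraMap K p.SplittingField)).Splits) := ⟨SplittingField.splits p⟩
  have hcard : Fintype.card (p.rootSet p.SplittingField) ≤ 4 := by
    rw [Fintype.card_eq_nat_card, Nat.card_coe_set_eq]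
    exact (p.ncard_rootSet_le p.SplittingField).trans hp
  haveI := perm_isSolvable_of_card_le_four hcard
  exact solvable_of_solvable_injective (Gal.galActionHom_injective p p.SplittingField)

/-! ## Constructors -/

namespace IsConjugationSolvable

variable {F : Type u} [Field F]

/-- Constructor from instances: a tower `F₀ ⊆ F ⊆ E` of number fields, `F₀` totally real,
`E/F₀` Galois with solvable group. [folklore] -/
theorem intro (F₀ E : Type u) [Field F₀] [NumberField F₀] [Field E] [NumberField E]
    [Algebra F₀ F] [Algebra F E] [Algebra F₀ E] [IsScalarTower F₀ F E] [IsGalois F₀ E]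
    [IsTotallyReal F₀] (hE : IsSolvable (E ≃ₐ[F₀] E)) : IsConjugationSolvable F :=
  ⟨F₀, E, ‹_›, ‹_›, ‹_›, ‹_›, ‹_›, ‹_›, ‹_›, ‹_›, ‹_›, ‹_›, hE⟩

/-- A number field which is itself Galois with solvable group over a totally real subfield is
conjugation-solvable (`E = F`). [folklore] -/
theorem of_isGalois (F₀ : Type u) [Field F₀] [NumberField F₀] [IsTotallyReal F₀] [Algebra F₀ F]
    [NumberField F] [IsGalois F₀ F] (h : IsSolvable (F ≃ₐ[F₀] F)) : IsConjugationSolvable F :=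
  intro F₀ F h

/-- Totally real fields are conjugation-solvable (`F₀ = E = F`). [folklore] -/
theorem of_isTotallyReal [NumberField F] [IsTotallyReal F] : IsConjugationSolvable F :=
  of_isGalois (F := F) F inferInstance

/-- Every extension `F/F₀` of degree `≤ 4` of a totally real number field `F₀` is
conjugation-solvable: with `F = F₀(α)`, the splitting field `E` of the minimal polynomial of `α`
is Galois over `F₀` with group a subgroup of `S₄`, which is solvable. [folklore] -/
theorem of_finrank_le_four (F₀ : Type u) [Field F₀] [NumberField F₀] [IsTotallyReal F₀]
    [Algebra F₀ F] [NumberField F] (h : finrank F₀ F ≤ 4) : IsConjugationSolvable F := by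
  obtain ⟨α, hα⟩ := Field.exists_primitive_element F₀ F
  have hint : IsIntegral F₀ α := .of_finite F₀ α
  have hirr : Irreducible (minpoly F₀ α) := minpoly.irreducible hint
  haveI : Fact (((minpoly F₀ α).map (algebraMap F₀ (minpoly F₀ α).SplittingField)).Splits) :=
    ⟨SplittingField.splits _⟩
  haveI : IsGalois F₀ (minpoly F₀ α).SplittingField :=
    IsGalois.of_separable_splitting_field hirr.separable
  haveI : NumberField (minpoly F₀ α).SplittingField := NumberField.of_module_finite F₀ _
  have hK : ∀ s ∈ ({α} : Set F), IsIntegral F₀ s ∧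
      ((minpoly F₀ s).map (algebraMap F₀ (minpoly F₀ α).SplittingField)).Splits := by
    intro s hs
    rw [Set.mem_singleton_iff] at hs
    subst hs
    exact ⟨hint, SplittingField.splits _⟩
  obtain ⟨φ⟩ : Nonempty (F →ₐ[F₀] (minpoly F₀ α).SplittingField) :=
    IntermediateField.nonempty_algHom_of_adjoin_splits hK hα
  letI : Algebra F (minpoly F₀ α).SplittingField := φ.toRingHom.toAlgebra
  haveI : IsScalarTower F₀ F (minpoly F₀ α).SplittingField :=
    IsScalarTower.of_algebraMap_eq fun x => (φ.commutes x).symm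
  exact intro F₀ (minpoly F₀ α).SplittingField
    (gal_isSolvable_of_natDegree_le_four ((minpoly.natDegree_le α).trans h))

/-- Quadratic extensions of totally real fields are conjugation-solvable. [folklore] -/
theorem of_finrank_eq_two (F₀ : Type u) [Field F₀] [NumberField F₀] [IsTotallyReal F₀]
    [Algebra F₀ F] [NumberField F] (h : finrank F₀ F = 2) : IsConjugationSolvable F :=
  of_finrank_le_four F₀ (h ▸ by norm_num)

/-- CM fields are conjugation-solvable (quadratic over the maximal real subfield). [folklore] -/
theorem of_isCMField [NumberField F] [IsCMField F] : IsConjugationSolvable F :=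
  of_finrank_eq_two (maximalRealSubfield F)
    (Algebra.IsQuadraticExtension.finrank_eq_two (maximalRealSubfield F) F)

/-- Every number field of absolute degree `≤ 4` is conjugation-solvable (`F₀ = ℚ`, realised in
the universe of `F` as `⊥ : IntermediateField ℚ F`); in particular pure cubic fields `ℚ(∛m)`
and `ℚ(2^{1/4})`. [folklore] -/
theorem of_finrank_rat_le_four [NumberField F] (h : finrank ℚ F ≤ 4) :
    IsConjugationSolvable F := by
  haveI : IsTotallyReal (⊥ : IntermediateField ℚ F) :=
    IsTotallyReal.ofRingEquiv (IntermediateField.botEquiv ℚ F).symm.toRingEquiv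
  refine of_finrank_le_four (⊥ : IntermediateField ℚ F) ?_
  rwa [IntermediateField.finrank_bot']

/-! ## The intrinsic form: Galois and solvable over the maximal real subfield -/

/-- A totally real subfield `F₀ ⊆ F` lands in the maximal real subfield `F⁺` of `F`.
[folklore] -/
theorem algebraMap_mem_maximalRealSubfield (F₀ : Type*) [Field F₀] [IsTotallyReal F₀]
    [Algebra F₀ F] (x : F₀) : algebraMap F₀ F x ∈ maximalRealSubfield F := by
  intro φ
  rw [RCLike.star_def]
  have h := RingHom.congr_fun (ComplexEmbedding.isReal_iff.mp
    (IsTotallyReal.complexEmbedding_isReal (φ.comp (algebraMap F₀ F)))) x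
  rwa [ComplexEmbedding.conjugate_coe_eq] at h

/-- **Intrinsic form.** `F` is conjugation-solvable iff some number field `E ⊇ F` is Galois over
the maximal real subfield `F⁺ = NumberField.maximalRealSubfield F` (for the induced `F⁺`-algebra
structure `F⁺ ⊆ F → E`, Mathlib's `Algebra.ofSubsemiring`) with solvable group `Gal(E/F⁺)`, i.e.
iff the Galois closure of `F/F⁺` is solvable.  (`→`: a totally real `F₀ ⊆ F` lies in `F⁺`
(`algebraMap_mem_maximalRealSubfield`), `E/F₀` Galois forces `E/F⁺` Galois, and
`Gal(E/F⁺) ≤ Gal(E/F₀)`.) [folklore] -/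
theorem iff_maximalRealSubfield [NumberField F] :
    IsConjugationSolvable F ↔
      ∃ (E : Type u) (_ : Field E) (_ : NumberField E) (_ : Algebra F E)
        (_ : IsGalois (maximalRealSubfield F) E), IsSolvable (E ≃ₐ[maximalRealSubfield F] E) := by
  constructor
  · rintro ⟨F₀, E, _, _, _, _, _, _, _, _, _, hF₀, hE⟩
    haveI := hF₀
    haveI := hE
    letI algK : Algebra F₀ (maximalRealSubfield F) :=
      ((algebraMap F₀ F).codRestrict (maximalRealSubfield F)
        (algebraMap_mem_maximalRealSubfield F₀)).toAlgebra
    haveI : IsScalarTower F₀ (maximalRealSubfield F) E :=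
      IsScalarTower.of_algebraMap_eq fun x => by
        rw [IsScalarTower.algebraMap_apply F₀ F E x]
        rfl
    haveI : IsGalois (maximalRealSubfield F) E :=
      IsGalois.tower_top_of_isGalois F₀ (maximalRealSubfield F) E
    let r : (E ≃ₐ[maximalRealSubfield F] E) →* (E ≃ₐ[F₀] E) :=
      { toFun := AlgEquiv.restrictScalars F₀
        map_one' := rfl
        map_mul' := fun _ _ => rfl }
    have hr : Function.Injective r := AlgEquiv.restrictScalars_injective F₀
    exact ⟨E, ‹_›, ‹_›, ‹_›, ‹_›, solvable_of_solvable_injective hr⟩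
  · rintro ⟨E, _, _, _, _, hE⟩
    exact intro (maximalRealSubfield F) E hE

/-- The intrinsic form as a constructor: `E ⊇ F` Galois with solvable group over `F⁺`.
[folklore] -/
theorem of_maximalRealSubfield [NumberField F] (E : Type u) [Field E] [NumberField E]
    [Algebra F E] [IsGalois (maximalRealSubfield F) E]
    (hE : IsSolvable (E ≃ₐ[maximalRealSubfield F] E)) : IsConjugationSolvable F :=
  intro (maximalRealSubfield F) E hE

/-! ## An obstruction: prime degree, a complex place, an insoluble minimal polynomial -/

/-- **Negative criterion.** Let `F` be a number field of PRIME absolute degree which is not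
totally real, containing an element `α` whose minimal polynomial over `ℚ` has insoluble Galois
group.  Then `F` is not conjugation-solvable: a totally real `F₀ ⊆ F` has `[F₀:ℚ] ∈ {1, p}`,
`F₀ = F` is excluded (not totally real), so `F₀ = ℚ`; then `E/ℚ` is Galois with solvable group
and `Gal(minpoly ℚ α)` is a quotient of `Gal(E/ℚ)` — contradiction. [folklore] -/
theorem not_of_prime_finrank [NumberField F] (hp : (finrank ℚ F).Prime)
    (hF : ¬ IsTotallyReal F) {α : F} (hα : ¬ IsSolvable (minpoly ℚ α).Gal) :
    ¬ IsConjugationSolvable F := by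
  rintro ⟨F₀, E, _, _, _, _, _, _, _, _, _, hF₀, hE⟩
  haveI := hF₀
  haveI := hE
  have htower : finrank ℚ F₀ * finrank F₀ F = finrank ℚ F := Module.finrank_mul_finrank ℚ F₀ F
  rcases (Nat.dvd_prime hp).mp (Dvd.intro _ htower) with h1 | h1
  · -- `F₀ = ℚ`: transfer Galois-ness and solvability from `F₀` to `ℚ`
    have hE₀ : finrank F₀ E = finrank ℚ E := by
      have := Module.finrank_mul_finrank ℚ F₀ E
      rw [h1, one_mul] at this
      exact this
    let r : (E ≃ₐ[F₀] E) →* (E ≃ₐ[ℚ] E) :=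
      { toFun := AlgEquiv.restrictScalars ℚ
        map_one' := rfl
        map_mul' := fun _ _ => rfl }
    have hr : Function.Injective r := AlgEquiv.restrictScalars_injective ℚ
    have hle : Nat.card (E ≃ₐ[ℚ] E) ≤ finrank ℚ E := by
      rw [Nat.card_eq_fintype_card]; exact AlgEquiv.card_le
    have hcard : Nat.card (E ≃ₐ[F₀] E) = finrank F₀ E := IsGalois.card_aut_eq_finrank F₀ E
    have hbij : Function.Bijective r :=
      hr.bijective_of_nat_card_le (by rw [hcard, hE₀]; exact hle)
    haveI : IsGalois ℚ E := by
      refine IsGalois.of_card_aut_eq_finrank ℚ E (le_antisymm hle ?_)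
      rw [← hE₀, ← hcard]
      exact Nat.card_le_card_of_injective r hr
    haveI : IsSolvable (E ≃ₐ[ℚ] E) := solvable_of_surjective hbij.surjective
    have hmin : minpoly ℚ (algebraMap F E α) = minpoly ℚ α :=
      minpoly.algebraMap_eq (algebraMap F E).injective α
    haveI : Fact (((minpoly ℚ α).map (algebraMap ℚ E)).Splits) :=
      ⟨hmin ▸ Normal.splits inferInstance (algebraMap F E α)⟩
    exact hα (solvable_of_surjective (Gal.restrict_surjective (minpoly ℚ α) E))
  · -- `F₀ = F`: then `F` would be totally real
    have h1' : finrank F₀ F = 1 := by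
      rw [h1] at htower
      exact (Nat.mul_right_inj hp.ne_zero).mp (htower.trans (mul_one _).symm)
    have hsurj : Function.Surjective (algebraMap F₀ F) := fun y => by
      have hy : y ∈ (⊤ : Subalgebra F₀ F) := Algebra.mem_top
      rw [← Subalgebra.bot_eq_top_of_finrank_eq_one h1'] at hy
      exact Algebra.mem_bot.mp hy
    exact hF (IsTotallyReal.ofRingEquiv
      (RingEquiv.ofBijective (algebraMap F₀ F) ⟨(algebraMap F₀ F).injective, hsurj⟩))

/-- In particular an `S₅`-quintic field with a complex place (degree `5`, not totally real,
generated by a root of a quintic with Galois group `S₅`) is not conjugation-solvable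
(`Equiv.Perm.fin_5_not_solvable`); for `A₅` use `not_of_prime_finrank` with the tree's
`alternatingGroup_five_not_isSolvable`. [folklore] -/
theorem not_of_prime_finrank_of_mulEquiv_perm_fin_five [NumberField F]
    (hp : (finrank ℚ F).Prime) (hF : ¬ IsTotallyReal F) {α : F}
    (e : (minpoly ℚ α).Gal ≃* Equiv.Perm (Fin 5)) : ¬ IsConjugationSolvable F :=
  not_of_prime_finrank hp hF (α := α) fun h => by
    haveI := h
    exact Equiv.Perm.fin_5_not_solvable
      (solvable_of_surjective (G := (minpoly ℚ α).Gal) (G' := Equiv.Perm (Fin 5))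
        (f := e.toMonoidHom) e.surjective)

end IsConjugationSolvable

end Literature.NumberTheory.NumberFields
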